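import Mathlib
import HarnessLib
import Literature.ModelTheory.FiniteModelTheory.StructCkEquiv
import Summits.ValiantsHypothesis.ValiantsHypothesis.Theorems.SymmetryDialAffinePebbleThree

/-!
# SymmetryDial — four pebble pairs see the third-order pattern counts (a proved round-1 filter at `k′ = 4`)

Route `SymmetryDial` (workshop `decomp-valiant`, lens 1, gen 8, Addendum B (c)), item 23711
(P′ = `AffinePebblePairs`).  For the Cayley (group) matrix `M_f(x,y) = f(x+y)` of `f : 𝔽₂^d → 𝔽₂` and a
pattern `ε ∈ 𝔽₂³`, the THIRD-ORDER PATTERN COUNT of a triple of points is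
`triCount f ε a b c = #{x : f(a+x) = ε₁ ∧ f(b+x) = ε₂ ∧ f(c+x) = ε₃}` (a function of the two differences
`a+b, a+c`; its signed version is the third-order autocorrelation `Σ_x (−1)^{f(x)+f(x+u)+f(x+v)}`).
**Theorem** (`triCount_of_pebbleEquiv_four`): if `𝔄(M_f) ≡_{C⁴} 𝔄(M_g)` then there are nested
bijections `a ↦ a'`, `b ↦ b'` (depending on `a`), `c ↦ c'` (depending on `a, b`) with
`triCount f ε a b c = triCount g ε a' b' c'` for every `ε` — four rounds of Duplicator's moves and the
preservation of `mat` on the pebbled pairs `(a,x), (b,x), (c,x)`.  **Corollary**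
(`triCount_multiset_eq`): the multisets over all triples of the pattern-count vectors agree; the census
uses the contrapositive (`not_pebbleEquiv_of_triProfile_ne`) as a CERTIFIED round-1 separation test at
pebble number 4.  §3 adds the ATOMIC TYPE of the pebbled triple (`f(a+b), f(a+c), f(b+c)`) to the profile
(`triCountTyped_of_pebbleEquiv_four`, `typedTriProfile_multiset_eq`, `not_pebbleEquiv_of_typedTriProfile_ne`):
this joint profile is the census's round-1 point colour `I_T` (Addendum B §B.2), which separates 16 of the 17
round-1 pairs of the E1 habitat while the untyped profile is constant there (all ten structures have
`|T3| ≡ 2^{d/2}`).  Instrument side only (LADDER-Valiant rung 0); nothing here bears on VP ≠ VNP.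
-/

namespace Summit.ValiantsHypothesis.ValiantsHypothesis.Theorems.SymmetryDialAffinePebbleFour

open Finset
open Literature.ModelTheory.FiniteModelTheory
open SymmetryDialAffinePebble (V AffRel Laff pair RelHolds affStr AffinePebbleEquiv affinePebbleEquiv_mono)
open SymmetryDialAffinePebbleThree (grpMat exists_inl_of_partialIso mat_iff_of_partialIso)

variable {d : ℕ}

/-- Third-order pattern count of a triple of points: `#{x : f(a+x) = ε₁ ∧ f(b+x) = ε₂ ∧ f(c+x) = ε₃}`. -/
def triCount (f : V d → Bool) (ε : Bool × Bool × Bool) (a b c : V d) : ℕ :=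
  ((univ : Finset (V d)).filter fun x => f (a + x) = ε.1 ∧ f (b + x) = ε.2.1 ∧ f (c + x) = ε.2.2).card

/-- The pattern-count vector of a triple. -/
def triProfile (f : V d → Bool) (t : V d × V d × V d) : Bool × Bool × Bool → ℕ :=
  fun ε => triCount f ε t.1 t.2.1 t.2.2

/-- `Bool` bookkeeping: from `p = true ↔ q = true` to `p = ε ↔ q = ε`. -/
theorem eq_iff_eq_of_iff {p q : Bool} (h : p = true ↔ q = true) (ε : Bool) : p = ε ↔ q = ε := by
  have : p = q := Bool.eq_iff_iff.2 h
  rw [this]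

/-- **Four pebble pairs see the third-order pattern counts** (nested bijections). -/
theorem triCount_of_pebbleEquiv_four (f g : V d → Bool)
    (h : AffinePebbleEquiv 4 d (grpMat f) (grpMat g)) :
    ∃ e₁ : V d → V d, Function.Bijective e₁ ∧ ∀ a, ∃ e₂ : V d → V d, Function.Bijective e₂ ∧
      ∀ b, ∃ e₃ : V d → V d, Function.Bijective e₃ ∧
        ∀ c ε, triCount f ε a b c = triCount g ε (e₁ a) (e₂ b) (e₃ c) := by
  classical
  obtain ⟨S, hS⟩ := h
  -- a generic step: from a position in `S`, moving pebble `i` onto a point yields a bijection of points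
  have step : ∀ {p : PebblePosition 4 (V d ⊕ V d) (V d ⊕ V d)} (_ : p ∈ S.positions) (i : Fin 4),
      ∃ e : V d → V d, Function.Bijective e ∧
        ∀ a, Function.update p i (some (Sum.inl a, Sum.inl (e a))) ∈ S.positions := by
    intro p hp i
    obtain ⟨φ, hφ⟩ := S.move hp i
    have he : ∀ a : V d, ∃ a' : V d, φ (.inl a) = .inl a' := fun a =>
      exists_inl_of_partialIso (hS (hφ (.inl a)))
        (show PebblePosition.Pebbled (Function.update p i (some (Sum.inl a, φ (Sum.inl a))))
          (Sum.inl a) (φ (Sum.inl a)) from ⟨i, by simp⟩)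
    choose e he using he
    have hinj : Function.Injective e := fun a b hab =>
      Sum.inl_injective (φ.injective (by rw [he a, he b, hab]))
    refine ⟨e, ⟨hinj, Finite.surjective_of_injective hinj⟩, fun a => ?_⟩
    have := hφ (.inl a); rwa [he a] at this
  -- round 1
  obtain ⟨e₁, he₁, h₁⟩ := step S.empty_mem 0
  refine ⟨e₁, he₁, fun a => ?_⟩
  set p₁ := Function.update (PebblePosition.empty : PebblePosition 4 (V d ⊕ V d) (V d ⊕ V d)) 0
    (some (Sum.inl a, Sum.inl (e₁ a))) with hp₁
  -- round 2
  obtain ⟨e₂, he₂, h₂⟩ := step (h₁ a) 1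
  refine ⟨e₂, he₂, fun b => ?_⟩
  set p₂ := Function.update p₁ 1 (some (Sum.inl b, Sum.inl (e₂ b))) with hp₂
  -- round 3
  obtain ⟨e₃, he₃, h₃⟩ := step (h₂ b) 2
  refine ⟨e₃, he₃, fun c ε => ?_⟩
  set p₃ := Function.update p₂ 2 (some (Sum.inl c, Sum.inl (e₃ c))) with hp₃
  -- round 4
  obtain ⟨e₄, he₄, h₄⟩ := step (h₃ c) 3
  set q : V d → PebblePosition 4 (V d ⊕ V d) (V d ⊕ V d) :=
    fun x => Function.update p₃ 3 (some (Sum.inl x, Sum.inl (e₄ x))) with hq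
  have hq_mem : ∀ x, q x ∈ S.positions := h₄
  -- reading the final positions
  have hq0 : ∀ x, (q x) 0 = some (Sum.inl a, Sum.inl (e₁ a)) := fun x => by
    simp only [hq]
    rw [Function.update_of_ne (by decide), hp₃, Function.update_of_ne (by decide), hp₂,
      Function.update_of_ne (by decide), hp₁, Function.update_self]
  have hq1 : ∀ x, (q x) 1 = some (Sum.inl b, Sum.inl (e₂ b)) := fun x => by
    simp only [hq]
    rw [Function.update_of_ne (by decide), hp₃, Function.update_of_ne (by decide), hp₂,
      Function.update_self]
  have hq2 : ∀ x, (q x) 2 = some (Sum.inl c, Sum.inl (e₃ c)) := fun x => by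
    simp only [hq]
    rw [Function.update_of_ne (by decide), hp₃, Function.update_self]
  have hq3 : ∀ x, (q x) 3 = some (Sum.inl x, Sum.inl (e₄ x)) := fun x => by
    simp only [hq]
    rw [Function.update_self]
  have hmat : ∀ x (u u' : V d) (j : Fin 4), (q x) j = some (Sum.inl u, Sum.inl u') →
      ∀ ε', (f (u + x) = ε' ↔ g (u' + e₄ x) = ε') := by
    intro x u u' j hj ε'
    have := mat_iff_of_partialIso (hS (hq_mem x)) ⟨j, hj⟩ ⟨3, hq3 x⟩
    exact eq_iff_eq_of_iff this ε'
  unfold triCount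
  refine card_bij (fun x _ => e₄ x) (fun x hx => ?_) (fun x _ y _ hxy => he₄.1 hxy) (fun y hy => ?_)
  · obtain ⟨-, hx1, hx2, hx3⟩ := mem_filter.1 hx
    exact mem_filter.2 ⟨mem_univ _, (hmat x a _ 0 (hq0 x) _).1 hx1,
      (hmat x b _ 1 (hq1 x) _).1 hx2, (hmat x c _ 2 (hq2 x) _).1 hx3⟩
  · obtain ⟨x, rfl⟩ := he₄.2 y
    obtain ⟨-, hy1, hy2, hy3⟩ := mem_filter.1 hy
    exact ⟨x, mem_filter.2 ⟨mem_univ _, (hmat x a _ 0 (hq0 x) _).2 hy1,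
      (hmat x b _ 1 (hq1 x) _).2 hy2, (hmat x c _ 2 (hq2 x) _).2 hy3⟩, rfl⟩

/-- **Corollary: equal multisets of third-order pattern-count vectors over all triples.** -/
theorem triProfile_multiset_eq (f g : V d → Bool) (h : AffinePebbleEquiv 4 d (grpMat f) (grpMat g)) :
    (univ : Finset (V d × V d × V d)).val.map (triProfile f) =
      (univ : Finset (V d × V d × V d)).val.map (triProfile g) := by
  classical
  obtain ⟨e₁, he₁, h₁⟩ := triCount_of_pebbleEquiv_four f g h
  choose e₂ he₂ h₂ using h₁
  choose e₃ he₃ h₃ using h₂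
  -- the triangular bijection of triples
  let T : V d × V d × V d → V d × V d × V d :=
    fun t => (e₁ t.1, e₂ t.1 t.2.1, e₃ t.1 t.2.1 t.2.2)
  have hT : Function.Injective T := by
    rintro ⟨a, b, c⟩ ⟨a', b', c'⟩ hh
    simp only [T, Prod.mk.injEq] at hh
    obtain ⟨ha, hb, hc⟩ := hh
    have ha' : a = a' := he₁.1 ha
    subst ha'
    have hb' : b = b' := (he₂ a).1 hb
    subst hb'
    have hc' : c = c' := (he₃ a b).1 hc
    subst hc'
    rfl
  have hTb : Function.Bijective T := ⟨hT, Finite.surjective_of_injective hT⟩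
  have hprof : ∀ t, triProfile f t = triProfile g (T t) := by
    rintro ⟨a, b, c⟩
    funext ε
    exact h₃ a b c ε
  have h1 : (univ : Finset (V d × V d × V d)).val.map (triProfile f) =
      (univ : Finset (V d × V d × V d)).val.map (triProfile g ∘ T) :=
    Multiset.map_congr rfl fun t _ => hprof t
  rw [h1, ← Multiset.map_map]
  congr 1
  exact (Multiset.map_univ_val_equiv (Equiv.ofBijective T hTb))

/-- Contrapositive, the census form: different third-order profiles separate at pebble number `4`
(hence at every `k′ ≥ 4`). -/
theorem not_pebbleEquiv_of_triProfile_ne {k' : ℕ} (hk : 4 ≤ k') (f g : V d → Bool)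
    (hne : (univ : Finset (V d × V d × V d)).val.map (triProfile f) ≠
      (univ : Finset (V d × V d × V d)).val.map (triProfile g)) :
    ¬ AffinePebbleEquiv k' d (grpMat f) (grpMat g) :=
  fun h => hne (triProfile_multiset_eq f g (affinePebbleEquiv_mono hk h))


/-! ## §3 The typed profile: pattern counts jointly with the atomic type of the triple -/

/-- **Typed version.**  The nested bijections also preserve the matrix entries on the pebbled pairs:
`f(a+b) = g(a'+b')`, `f(a+c) = g(a'+c')`, `f(b+c) = g(b'+c')`. -/
theorem triCountTyped_of_pebbleEquiv_four (f g : V d → Bool)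
    (h : AffinePebbleEquiv 4 d (grpMat f) (grpMat g)) :
    ∃ e₁ : V d → V d, Function.Bijective e₁ ∧ ∀ a, ∃ e₂ : V d → V d, Function.Bijective e₂ ∧
      ∀ b, ∃ e₃ : V d → V d, Function.Bijective e₃ ∧
        ∀ c, (f (a + b) = g (e₁ a + e₂ b) ∧ f (a + c) = g (e₁ a + e₃ c) ∧ f (b + c) = g (e₂ b + e₃ c)) ∧
          ∀ ε, triCount f ε a b c = triCount g ε (e₁ a) (e₂ b) (e₃ c) := by
  classical
  obtain ⟨S, hS⟩ := h
  have step : ∀ {p : PebblePosition 4 (V d ⊕ V d) (V d ⊕ V d)} (_ : p ∈ S.positions) (i : Fin 4),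
      ∃ e : V d → V d, Function.Bijective e ∧
        ∀ a, Function.update p i (some (Sum.inl a, Sum.inl (e a))) ∈ S.positions := by
    intro p hp i
    obtain ⟨φ, hφ⟩ := S.move hp i
    have he : ∀ a : V d, ∃ a' : V d, φ (.inl a) = .inl a' := fun a =>
      exists_inl_of_partialIso (hS (hφ (.inl a)))
        (show PebblePosition.Pebbled (Function.update p i (some (Sum.inl a, φ (Sum.inl a))))
          (Sum.inl a) (φ (Sum.inl a)) from ⟨i, by simp⟩)
    choose e he using he
    have hinj : Function.Injective e := fun a b hab =>
      Sum.inl_injective (φ.injective (by rw [he a, he b, hab]))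
    refine ⟨e, ⟨hinj, Finite.surjective_of_injective hinj⟩, fun a => ?_⟩
    have := hφ (.inl a); rwa [he a] at this
  obtain ⟨e₁, he₁, h₁⟩ := step S.empty_mem 0
  refine ⟨e₁, he₁, fun a => ?_⟩
  set p₁ := Function.update (PebblePosition.empty : PebblePosition 4 (V d ⊕ V d) (V d ⊕ V d)) 0
    (some (Sum.inl a, Sum.inl (e₁ a))) with hp₁
  obtain ⟨e₂, he₂, h₂⟩ := step (h₁ a) 1
  refine ⟨e₂, he₂, fun b => ?_⟩
  set p₂ := Function.update p₁ 1 (some (Sum.inl b, Sum.inl (e₂ b))) with hp₂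
  obtain ⟨e₃, he₃, h₃⟩ := step (h₂ b) 2
  refine ⟨e₃, he₃, fun c => ?_⟩
  set p₃ := Function.update p₂ 2 (some (Sum.inl c, Sum.inl (e₃ c))) with hp₃
  obtain ⟨e₄, he₄, h₄⟩ := step (h₃ c) 3
  set q : V d → PebblePosition 4 (V d ⊕ V d) (V d ⊕ V d) :=
    fun x => Function.update p₃ 3 (some (Sum.inl x, Sum.inl (e₄ x))) with hq
  have hq_mem : ∀ x, q x ∈ S.positions := h₄
  have hq0 : ∀ x, (q x) 0 = some (Sum.inl a, Sum.inl (e₁ a)) := fun x => by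
    simp only [hq]
    rw [Function.update_of_ne (by decide), hp₃, Function.update_of_ne (by decide), hp₂,
      Function.update_of_ne (by decide), hp₁, Function.update_self]
  have hq1 : ∀ x, (q x) 1 = some (Sum.inl b, Sum.inl (e₂ b)) := fun x => by
    simp only [hq]
    rw [Function.update_of_ne (by decide), hp₃, Function.update_of_ne (by decide), hp₂,
      Function.update_self]
  have hq2 : ∀ x, (q x) 2 = some (Sum.inl c, Sum.inl (e₃ c)) := fun x => by
    simp only [hq]
    rw [Function.update_of_ne (by decide), hp₃, Function.update_self]
  have hq3 : ∀ x, (q x) 3 = some (Sum.inl x, Sum.inl (e₄ x)) := fun x => by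
    simp only [hq]
    rw [Function.update_self]
  -- matrix entries on any two pebbled points
  have hmat2 : ∀ x (u u' v v' : V d) (j j' : Fin 4), (q x) j = some (Sum.inl u, Sum.inl u') →
      (q x) j' = some (Sum.inl v, Sum.inl v') → ∀ ε', (f (u + v) = ε' ↔ g (u' + v') = ε') :=
    fun x u u' v v' j j' hj hj' ε' =>
      eq_iff_eq_of_iff (mat_iff_of_partialIso (hS (hq_mem x)) ⟨j, hj⟩ ⟨j', hj'⟩) ε'
  refine ⟨⟨?_, ?_, ?_⟩, fun ε => ?_⟩
  · exact (hmat2 0 a _ b _ 0 1 (hq0 0) (hq1 0) (g (e₁ a + e₂ b))).2 rfl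
  · exact (hmat2 0 a _ c _ 0 2 (hq0 0) (hq2 0) (g (e₁ a + e₃ c))).2 rfl
  · exact (hmat2 0 b _ c _ 1 2 (hq1 0) (hq2 0) (g (e₂ b + e₃ c))).2 rfl
  unfold triCount
  refine card_bij (fun x _ => e₄ x) (fun x hx => ?_) (fun x _ y _ hxy => he₄.1 hxy) (fun y hy => ?_)
  · obtain ⟨-, hx1, hx2, hx3⟩ := mem_filter.1 hx
    exact mem_filter.2 ⟨mem_univ _, (hmat2 x a _ x _ 0 3 (hq0 x) (hq3 x) _).1 hx1,
      (hmat2 x b _ x _ 1 3 (hq1 x) (hq3 x) _).1 hx2, (hmat2 x c _ x _ 2 3 (hq2 x) (hq3 x) _).1 hx3⟩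
  · obtain ⟨x, rfl⟩ := he₄.2 y
    obtain ⟨-, hy1, hy2, hy3⟩ := mem_filter.1 hy
    exact ⟨x, mem_filter.2 ⟨mem_univ _, (hmat2 x a _ x _ 0 3 (hq0 x) (hq3 x) _).2 hy1,
      (hmat2 x b _ x _ 1 3 (hq1 x) (hq3 x) _).2 hy2, (hmat2 x c _ x _ 2 3 (hq2 x) (hq3 x) _).2 hy3⟩, rfl⟩

/-- The typed profile of a triple: atomic type `(f(a+b), f(a+c), f(b+c))` and the pattern-count vector. -/
def typedTriProfile (f : V d → Bool) (t : V d × V d × V d) :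
    (Bool × Bool × Bool) × (Bool × Bool × Bool → ℕ) :=
  ((f (t.1 + t.2.1), f (t.1 + t.2.2), f (t.2.1 + t.2.2)), triProfile f t)

/-- **Corollary: equal multisets of TYPED third-order profiles** (the census's round-1 point colour `I_T`). -/
theorem typedTriProfile_multiset_eq (f g : V d → Bool) (h : AffinePebbleEquiv 4 d (grpMat f) (grpMat g)) :
    (univ : Finset (V d × V d × V d)).val.map (typedTriProfile f) =
      (univ : Finset (V d × V d × V d)).val.map (typedTriProfile g) := by
  classical
  obtain ⟨e₁, he₁, h₁⟩ := triCountTyped_of_pebbleEquiv_four f g h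
  choose e₂ he₂ h₂ using h₁
  choose e₃ he₃ h₃ using h₂
  let T : V d × V d × V d → V d × V d × V d :=
    fun t => (e₁ t.1, e₂ t.1 t.2.1, e₃ t.1 t.2.1 t.2.2)
  have hT : Function.Injective T := by
    rintro ⟨a, b, c⟩ ⟨a', b', c'⟩ hh
    simp only [T, Prod.mk.injEq] at hh
    obtain ⟨ha, hb, hc⟩ := hh
    have ha' : a = a' := he₁.1 ha
    subst ha'
    have hb' : b = b' := (he₂ a).1 hb
    subst hb'
    have hc' : c = c' := (he₃ a b).1 hc
    subst hc'
    rfl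
  have hTb : Function.Bijective T := ⟨hT, Finite.surjective_of_injective hT⟩
  have hprof : ∀ t, typedTriProfile f t = typedTriProfile g (T t) := by
    rintro ⟨a, b, c⟩
    obtain ⟨⟨hab, hac, hbc⟩, hcnt⟩ := h₃ a b c
    simp only [typedTriProfile, T, hab, hac, hbc]
    refine congrArg _ (funext fun ε => hcnt ε)
  have h1 : (univ : Finset (V d × V d × V d)).val.map (typedTriProfile f) =
      (univ : Finset (V d × V d × V d)).val.map (typedTriProfile g ∘ T) :=
    Multiset.map_congr rfl fun t _ => hprof t
  rw [h1, ← Multiset.map_map]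
  congr 1
  exact (Multiset.map_univ_val_equiv (Equiv.ofBijective T hTb))

/-- Contrapositive, the census form with atomic types (every `k′ ≥ 4`). -/
theorem not_pebbleEquiv_of_typedTriProfile_ne {k' : ℕ} (hk : 4 ≤ k') (f g : V d → Bool)
    (hne : (univ : Finset (V d × V d × V d)).val.map (typedTriProfile f) ≠
      (univ : Finset (V d × V d × V d)).val.map (typedTriProfile g)) :
    ¬ AffinePebbleEquiv k' d (grpMat f) (grpMat g) :=
  fun h => hne (typedTriProfile_multiset_eq f g (affinePebbleEquiv_mono hk h))

end Summit.ValiantsHypothesis.ValiantsHypothesis.Theorems.SymmetryDialAffinePebbleFour
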